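import Literature.IUT.HodgeArakelov.GaloisPairRigidityNonVacuity
import Literature.AnabelianGeometry.AbsoluteAnabelian.GaloisCyclotomeAction
import HarnessLib

/-!
# Bridge B12: [IUTchII] Cor. 1.11's `μ_Ẑ(G)` IS the group-theoretic cyclotome of [AbsTopIII] Cor. 1.10 (i)(a)

Mochizuki, *Inter-universal Teichmüller theory II*, §1, Corollary 1.11, kurims manuscript (Dec. 2020) p. 49
[claim: Mochizuki2012, status: disputed] (IUTchII §1 Cor 1.11, kurims p.49); Mochizuki, *Topics in Absolute
Anabelian Geometry III*, §1, Cor. 1.10 (i)(a) pp. 41–42 (`μ_Ẑ(G) := Hom(ℚ/ℤ, lim_{→H} (H^ab)_tors)`, "the arrows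
of the direct limit are induced by the Verlagerung"), Cor. 1.10 (c) p. 42 ("the natural isomorphism
`μ_Ẑ(G_k) ⥲ μ_Ẑ(Π_X)`"), Rmk. 3.2.1 (the cyclotomic rigidity isomorphism `μ_Ẑ(G) ⥲ μ_Ẑ(O^×(G))` of an
MLF-Galois pair). Record-only typing under the claim key `Mochizuki2012` (D-0012, disputed); abc-iut cell,
layer L6, `plan/L6/MERGE-MAP.md` §8 row **B12** (holder abc-iut-w4-d024), node `IUTchII:Cor1.11`.

STATE BEFORE THIS FILE. abc-iut-L6-t1's `GaloisPairRigidityData A` (`GaloisPairRigidity.lean`, p409065) carries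
the data of Corollary 1.11 as an INTERFACE whose first component is an ABSTRACT assignment
`muZhat : IsoClass S.Gk → Type u` "`μ_Ẑ(G)`" with abstract transport `mapMu`; the sub-DAG files of
abc-iut-w5-d089 (`GaloisPairRigiditySubdag*`, p413682/p413731/p414121) build the functor `ℛ → ℱ` of the
corollary modulo the reduced `Π`-transport input `LDTransport`, and `GaloisPairRigidityNonVacuity` (p414609)
inhabits everything by the DEGENERATE tautological data `μ_Ẑ(G) := Λ(O^×(G))`.

THIS FILE (bridge of record, MERGE-MAP B12): the component `μ_Ẑ(G)` is made GENUINE — for every isomorph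
`G` of `G_k` it is abc-iut-L4-t1's group-theoretic cyclotome
`Literature.AnabelianGeometry.AbsoluteAnabelian.muZhat G` = `Hom(ℚ/ℤ, lim_{→ H ⊆ G open} (H^ab)_tors)` along
the Verlagerung ([AbsTopIII] Cor. 1.10 (i)(a), `GaloisCyclotome*.lean` — a REAL construction over Mathlib for
any compact topological group), transported along isomorphisms `G ≅ G*` by L4-t1's `muZhat.congr`
("recovered group-theoretically"):

* `IsoClass.compactSpace_carrier` — every isomorph of a compact `P` is compact (so `μ_Ẑ(G)` makes sense for
  every object of `IsoClass G_k` once `G_k` is compact: hypothesis `[CompactSpace S.Gk]`, i.e. `G_k` profinite);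
* `IsoClass.galCyclotome G` = `μ_Ẑ(G)`; `IsoClass.galCyclotomeMap f` = `μ_Ẑ(f)`; functor laws
  `galCyclotomeMap_id/_comp` PROVED; `galCyclotomeMap_smul` — `μ_Ẑ(f)` is EQUIVARIANT for the natural
  `G`-, `G*`-module structures (conjugation action = "the natural cyclotomic character", Cor. 1.11 (b)
  l. 23 / [AbsAnab] Prop. 1.2.1 (vi)) along `f` — PROVED: the "topological `G`-module" structure of the domain of
  `(*bs-Gal_{G,⊳})` that the interface does not carry is thereby REAL and functorial;
* the three CITED isomorphisms, for which the tree has no owner construction over the abstract [AbsTopIII]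
  output interface `A : AbsTopMonoids S`, as THREE SMALL NAMED INPUT structures over the genuine `μ_Ẑ`:
  `GalTwistInput S` (the `Ẑ^×`-twist on `μ_Ẑ(G)`, natural), `GalRigidityInput A` ((a): Rmk. 3.2.1
  `μ_Ẑ(G) ⥲ Λ(O^×(G))`, natural in `G ≅ G*`), `GalThetaSyncInput A` ((b): `(l·Δ_Θ)(Π)` with its `Π`-transport
  and the Cor. 1.10 (c) isomorphism `μ_Ẑ(Π/Δ) ⥲ (l·Δ_Θ)(Π)`, natural through the CONSTRUCTED `quotMap`);
* OUTPUT: `GaloisPairRigidityData.ofGaloisCyclotome` (t1's interface INHABITED with genuine `μ_Ẑ`),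
  `GaloisPairRigidityData.ofGaloisCyclotomeLD` (w5-d089's `LDTransport` for it), the Cor. 1.11 functor of record
  `cor111FunctorGalois` with its multiradiality `cor111FunctorGalois_multiradiallyDefined`;
* non-vacuity of the two inputs that do not tie `A` to `G`: `GalTwistInput.trivial`, `GalThetaSyncInput.tautological`
  (DEGENERATE witnesses, labelled so). `GalRigidityInput A` genuinely constrains `A` (for the trivial monoid
  interface it is empty, `μ_Ẑ(G_k)` being nontrivial for an MLF) — it is the [AbsTopIII] Rmk. 3.2.1 content and
  stays an input (owner side: abc-iut-L4-t2's MLF-Galois pair reconstruction; no decl over `AbsTopMonoids`).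

HONEST LIMITS: nothing of abc-iut-L6-t1 / abc-iut-w5-d089 / abc-iut-L4-t1 is edited or restated; no named
`Prop` fact is introduced; the inputs are DATA structures quoting print; nothing here bears on [IUTchIII]
Cor. 3.12 and no side is taken; typed ≠ discharged.
-/

noncomputable section

namespace Literature.IUT.HodgeArakelov

open CategoryTheory
open Literature.AnabelianGeometry.AbsoluteAnabelian
open Literature.AnabelianGeometry.EtaleTheta (cyclotome)

universe u

/-! ## `μ_Ẑ(G)` for every isomorph `G` of a compact group, functorially (REAL) -/

namespace IsoClass

variable {P : TopGroup.{u}} [CompactSpace P]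

/-- Every isomorph `G ≅ P` of a compact topological group `P` is compact (transport along the chosen
isomorphism of topological groups; `CompactSpace` is a proposition, so the choice is immaterial). For
`P = G_k = Gal(k̄/k)` (profinite) this makes [AbsTopIII] Cor. 1.10 (i)(a)'s `μ_Ẑ(G)` available at every object
of `IsoClass G_k`. [cite: MochizukiAbsTopIII2015, Cor 1.10 (i) p.41] -/
theorem compactSpace_carrier (X : IsoClass P) : CompactSpace X.G := by
  obtain ⟨e⟩ := X.iso
  exact e.symm.toHomeomorph.compactSpace

/-- **`μ_Ẑ(G)`** for an isomorph `G` of the compact group `P` ([IUTchII] Cor. 1.11 "the cyclotome `μ_Ẑ(G)`";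
[AbsTopIII] Cor. 1.10 (i)(a) `μ_Ẑ(G) := Hom(ℚ/ℤ, μ_{ℚ/ℤ}(G))`, `μ_{ℚ/ℤ}(G) := lim_{→H} (H^ab)_tors`): abc-iut-L4-t1's
GENUINE group-theoretic cyclotome `muZhat G` (a subgroup of `∏_n μ_{ℚ/ℤ}(G)`, read multiplicatively).
[claim: Mochizuki2012, status: disputed] (IUTchII §1 Cor 1.11, kurims p.49) -/
abbrev galCyclotome (X : IsoClass P) :
    Subgroup (ℕ+ → Multiplicative (@muQZ X.G _ _ _ X.compactSpace_carrier)) :=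
  @muZhat X.G _ _ _ X.compactSpace_carrier

/-- **`μ_Ẑ(f) : μ_Ẑ(G) ⥲ μ_Ẑ(G*)`** for an isomorphism of topological groups `f : G ≅ G*` ([IUTchII] Cor. 1.11
(b) "the poly-isomorphism induced by applying `μ_Ẑ(−)` to … `α`"; [AbsTopIII] Cor. 1.10 is "a functorial
group-theoretic algorithm"): abc-iut-L4-t1's transport `muZhat.congr` along `f`.
[claim: Mochizuki2012, status: disputed] (IUTchII §1 Cor 1.11, kurims p.49) -/
def galCyclotomeMap {X Y : IsoClass P} (f : X ⟶ Y) : X.galCyclotome ≃* Y.galCyclotome :=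
  @muZhat.congr X.G _ _ _ X.compactSpace_carrier Y.G _ _ _ Y.compactSpace_carrier (IsoClass.homIso f)

/-- Components of `μ_Ẑ(f)`: `(μ_Ẑ(f) ζ)_n = μ_{ℚ/ℤ}(f) (ζ_n)`. [claim: Mochizuki2012, status: disputed]
(IUTchII §1 Cor 1.11, kurims p.49) -/
theorem galCyclotomeMap_apply_coe {X Y : IsoClass P} (f : X ⟶ Y) (ζ : X.galCyclotome) (n : ℕ+) :
    ((galCyclotomeMap f ζ : Y.galCyclotome) : ℕ+ → _) n =
      Multiplicative.ofAdd (@muQZ.map X.G _ _ _ X.compactSpace_carrier Y.G _ _ _ Y.compactSpace_carrier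
        (IsoClass.homIso f) (Multiplicative.toAdd ((ζ : ℕ+ → _) n))) :=
  rfl

/-- Functor law `μ_Ẑ(𝟙 G) = 𝟙`. PROVED (`muQZ.map_refl`). [claim: Mochizuki2012, status: disputed]
(IUTchII §1 Cor 1.11, kurims p.49) -/
theorem galCyclotomeMap_id (X : IsoClass P) : galCyclotomeMap (𝟙 X) = MulEquiv.refl _ := by
  haveI := X.compactSpace_carrier
  refine MulEquiv.ext fun ζ => Subtype.ext (funext fun n => ?_)
  change Multiplicative.ofAdd (muQZ.map (ContinuousMulEquiv.refl X.G)
      (Multiplicative.toAdd ((ζ : ℕ+ → _) n))) = (ζ : ℕ+ → _) n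
  rw [muQZ.map_refl]
  rfl

/-- Functor law `μ_Ẑ(f ≫ g) = μ_Ẑ(f) ≫ μ_Ẑ(g)`. PROVED (`muQZ.map_trans`). [claim: Mochizuki2012, status: disputed]
(IUTchII §1 Cor 1.11, kurims p.49) -/
theorem galCyclotomeMap_comp {X Y Z : IsoClass P} (f : X ⟶ Y) (g : Y ⟶ Z) :
    galCyclotomeMap (f ≫ g) = (galCyclotomeMap f).trans (galCyclotomeMap g) := by
  haveI := X.compactSpace_carrier
  haveI := Y.compactSpace_carrier
  haveI := Z.compactSpace_carrier
  refine MulEquiv.ext fun ζ => Subtype.ext (funext fun n => ?_)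
  change Multiplicative.ofAdd (muQZ.map ((IsoClass.homIso f).trans (IsoClass.homIso g))
      (Multiplicative.toAdd ((ζ : ℕ+ → _) n))) =
    Multiplicative.ofAdd (muQZ.map (IsoClass.homIso g) (Multiplicative.toAdd (Multiplicative.ofAdd
      (muQZ.map (IsoClass.homIso f) (Multiplicative.toAdd ((ζ : ℕ+ → _) n))))))
  rw [muQZ.map_trans]
  rfl

/-- `μ_Ẑ(f⁻¹) = μ_Ẑ(f)⁻¹`. [claim: Mochizuki2012, status: disputed] (IUTchII §1 Cor 1.11, kurims p.49) -/
theorem galCyclotomeMap_inv {X Y : IsoClass P} (f : X ⟶ Y) :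
    galCyclotomeMap (inv f) = (galCyclotomeMap f).symm := by
  apply MulEquiv.ext
  intro x
  apply (galCyclotomeMap f).injective
  rw [MulEquiv.apply_symm_apply, ← MulEquiv.trans_apply, ← galCyclotomeMap_comp, IsIso.inv_hom_id,
    galCyclotomeMap_id]
  rfl

/-- **Equivariance of `μ_Ẑ(f)`** ([IUTchII] Cor. 1.11: "the topological `G`-modules constituted by the domain
and codomain of `(*bs-Gal_{G,⊳})`"; (b) l. 23 "`Aut(G)` … acts, via the natural cyclotomic character, on `μ_Ẑ(G)`
[cf., e.g., [AbsAnab], Proposition 1.2.1, (vi)]"): for the NATURAL `G`-module structure of `μ_Ẑ(G)` (L4-t1's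
conjugation action `muZhat.instMulDistribMulAction` — for `G = G_k` the cyclotomic character) and `g ∈ G`,
`μ_Ẑ(f) (g • ζ) = f(g) • μ_Ẑ(f) ζ`. PROVED (`μ_{ℚ/ℤ}`-transport composes and depends only on the underlying map;
`f ∘ conj_g = conj_{f g} ∘ f`). [claim: Mochizuki2012, status: disputed] (IUTchII §1 Cor 1.11, kurims p.49) -/
theorem galCyclotomeMap_smul {X Y : IsoClass P} (f : X ⟶ Y) (g : X.G) (ζ : X.galCyclotome) :
    haveI := X.compactSpace_carrier
    haveI := Y.compactSpace_carrier
    galCyclotomeMap f (g • ζ) = IsoClass.homIso f g • galCyclotomeMap f ζ := by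
  haveI := X.compactSpace_carrier
  haveI := Y.compactSpace_carrier
  refine Subtype.ext (funext fun n => ?_)
  change Multiplicative.ofAdd (muQZ.map (IsoClass.homIso f)
      (muQZ.map (conjContinuousMulEquiv g) (Multiplicative.toAdd ((ζ : ℕ+ → _) n)))) =
    Multiplicative.ofAdd (muQZ.map (conjContinuousMulEquiv (IsoClass.homIso f g))
      (muQZ.map (IsoClass.homIso f) (Multiplicative.toAdd ((ζ : ℕ+ → _) n))))
  rw [← muQZ.map_trans, ← muQZ.map_trans]
  congr 1
  exact muQZ.map_congr (fun x => by simp [map_mul, map_inv]) _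

end IsoClass

/-! ## The three cited inputs over the genuine `μ_Ẑ` (NAMED INPUT structures) -/

variable {S : ThetaSetting.{u}}

/-- INPUT (i) of **IUTchII:Cor1.11 (a)** (kurims p. 49 ll. 9–10 "the `Γ`-orbit `(*bs-Gal_{G,⊳})` … `Γ ⊆ Ẑ^×`";
Rmk. 1.11.1 (i)(b) "the natural action of `Ẑ^×`"): the `Ẑ^×`-twist on the GENUINE `μ_Ẑ(G)`, natural in
isomorphisms `G ≅ G*`. (The `Ẑ^×`-module structure of a cyclotome `Λ(−) = Hom(ℚ/ℤ, −)` through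
`Aut(ℚ/ℤ) = Ẑ^×` is classical; the tree's `EtaleTheta.cyclotome` does not yet carry it — `Cyclotome.lean`:
"the `Ẑ^×`-action on `Λ` … not formalised here" — hence an input; `GalTwistInput.trivial` is its degenerate
inhabitant.) [claim: Mochizuki2012, status: disputed] (IUTchII §1 Cor 1.11, kurims p.49) -/
structure GalTwistInput (S : ThetaSetting.{u}) [CompactSpace S.Gk] : Type (u + 1) where
  /-- the `Ẑ^×`-action on `μ_Ẑ(G)` -/
  twist : ∀ G : IsoClass S.Gk, ZHatUnits →* MulAut G.galCyclotome
  /-- naturality of the twist in `G ≅ G*` -/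
  twist_natural : ∀ {G H : IsoClass S.Gk} (f : G ⟶ H) (u : ZHatUnits) (x : G.galCyclotome),
    IsoClass.galCyclotomeMap f (twist G u x) = twist H u (IsoClass.galCyclotomeMap f x)

/-- INPUT (ii) of **IUTchII:Cor1.11 (a)** (kurims p. 49 ll. 9–21): "the cyclotomic rigidity isomorphism
`μ_Ẑ(G) ⥲ μ_Ẑ(O^×(G))` obtained by applying to the MLF-Galois pair determined by `G ↷ O^⊳(G)` the algorithm applied
to construct [the inverse of] the isomorphism `μ_Ẑ(M_TM) ⥲ μ_Ẑ(G)` in [AbsTopIII], Remark 3.2.1" — with SOURCE the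
GENUINE `μ_Ẑ(G)` and target t1's `μ_Ẑ(O^×(G)) := Λ(O^×(G))` (`AbsTopMonoids.muZhatUnits`), NATURAL in `G ≅ G*`
(both sides functorial: `μ_Ẑ(f)` and `Λ(O^×(f))`). This input genuinely ties the abstract [AbsTopIII] output
interface `A` to the Galois groups (it is empty for a degenerate `A`); owner side TODO-merge:abc-iut-L4-t2
([AbsTopIII] §3 MLF-Galois pairs). [claim: Mochizuki2012, status: disputed] (IUTchII §1 Cor 1.11, kurims p.49) -/
structure GalRigidityInput [CompactSpace S.Gk] (A : AbsTopMonoids S) : Type (u + 1) where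
  /-- `(*bs-Gal_{G,⊳})` representative: the cyclotomic rigidity isomorphism of [AbsTopIII] Rmk. 3.2.1 -/
  bsGalTri : ∀ G : IsoClass S.Gk, G.galCyclotome ≃* A.muZhatUnits G
  /-- naturality in `G ≅ G*` -/
  bsGalTri_natural : ∀ {G H : IsoClass S.Gk} (f : G ⟶ H) (x : G.galCyclotome),
    bsGalTri H (IsoClass.galCyclotomeMap f x) =
      cyclotome.map (Units.map (A.mapOtri f).toMonoidHom) (bsGalTri G x)

/-- INPUT (iii) of **IUTchII:Cor1.11 (b)** (kurims p. 49 ll. 22–35 + l. 43): "`(l·Δ_Θ)(Π)`" ([EtTh] Cor. 2.18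
(i): a functorial group-theoretic algorithm in `Π`) with its transport along `Π ≅ Π*`, and "the natural
isomorphism `μ_Ẑ(G_k) ⥲ μ_Ẑ(Π_X)` of [AbsTopIII], Corollary 1.10, (c)" composed to `(l·Δ_Θ)(Π)`, at the object
`Π/Δ` of `IsoClass G_k`, NATURAL through the CONSTRUCTED induced isomorphism of quotients `AbsTopMonoids.quotMap`
(abc-iut-w5-d089, p413731) — i.e. exactly the `Π`-side data of t1's interface plus the fields of w5-d089's reduced
input `GaloisPairRigidityData.LDTransport`, now over the GENUINE `μ_Ẑ(Π/Δ)`. Owner side: [AbsTopIII] Cor. 1.10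
(c) is FACT-LIST row F-0348 (`AbsTopIII.CurveModel.Cor_1_10_ii_c`, abc-iut-L4-t1) in the `CurveModel` vocabulary;
`(l·Δ_Θ)` of an abstract isomorph `Π` is abc-iut-L2's `RigidData` at the model (TODO-merge:abc-iut-L2-t2/L4-t1).
`GalThetaSyncInput.tautological` is its degenerate inhabitant. [claim: Mochizuki2012, status: disputed]
(IUTchII §1 Cor 1.11, kurims p.49) -/
structure GalThetaSyncInput [CompactSpace S.Gk] (A : AbsTopMonoids S) : Type (u + 1) where
  /-- `(l·Δ_Θ)(Π)` -/
  lDeltaTheta : IsoClass S.PiX → Type u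
  [grpLD : ∀ P, CommGroup (lDeltaTheta P)]
  /-- transport of `(l·Δ_Θ)(−)` along `Π ≅ Π*`, functorially -/
  mapLD : ∀ {P Q : IsoClass S.PiX}, (P ⟶ Q) → (lDeltaTheta P ≃* lDeltaTheta Q)
  mapLD_id : ∀ P : IsoClass S.PiX, mapLD (𝟙 P) = MulEquiv.refl (lDeltaTheta P)
  mapLD_comp : ∀ {P Q R : IsoClass S.PiX} (f : P ⟶ Q) (g : Q ⟶ R),
    mapLD (f ≫ g) = (mapLD f).trans (mapLD g)
  /-- [AbsTopIII] Cor. 1.10 (c) at `Π/Δ`: `μ_Ẑ(Π/Δ) ⥲ (l·Δ_Θ)(Π)` -/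
  corPiX : ∀ P : IsoClass S.PiX, (A.quotObj P).galCyclotome ≃* lDeltaTheta P
  /-- naturality of `corPiX` through `μ_Ẑ(quotMap h)` and `mapLD h` -/
  corPiX_natural : ∀ {P Q : IsoClass S.PiX} (h : P ⟶ Q) (x : (A.quotObj P).galCyclotome),
    corPiX Q (IsoClass.galCyclotomeMap (A.quotMap h) x) = mapLD h (corPiX P x)

/-! (The group structure `GalThetaSyncInput.grpLD` is consumed explicitly below — it becomes t1's instance
`GaloisPairRigidityData.grpLD` of the output — so no instance is registered on the input structure.) -/

/-! ## OUTPUT: t1's `GaloisPairRigidityData` and w5-d089's `LDTransport` over the genuine `μ_Ẑ` -/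

namespace GaloisPairRigidityData

variable [CompactSpace S.Gk] {A : AbsTopMonoids S}

/-- **B12, the instance of record of `GaloisPairRigidityData`** (IUTchII:Cor1.11, kurims p. 49): `μ_Ẑ(G)` :=
the GENUINE group-theoretic cyclotome of [AbsTopIII] Cor. 1.10 (i)(a) (`IsoClass.galCyclotome`), transported
by `μ_Ẑ(f)` (`IsoClass.galCyclotomeMap`, functor laws PROVED); the `Ẑ^×`-twist, the Rmk. 3.2.1 rigidity
isomorphism (a) and the Cor. 1.10 (c) datum (b) from the three named inputs.
[claim: Mochizuki2012, status: disputed] (IUTchII §1 Cor 1.11, kurims p.49) -/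
def ofGaloisCyclotome (T : GalTwistInput S) (R : GalRigidityInput A) (Y : GalThetaSyncInput A) :
    GaloisPairRigidityData A where
  muZhat G := G.galCyclotome
  grpMu G := by haveI := G.compactSpace_carrier; exact inferInstance
  mapMu f := IsoClass.galCyclotomeMap f
  mapMu_id G := IsoClass.galCyclotomeMap_id G
  mapMu_comp f g := IsoClass.galCyclotomeMap_comp f g
  twist := T.twist
  twist_natural f u x := T.twist_natural f u x
  bsGalTri := R.bsGalTri
  bsGalTri_natural f x := R.bsGalTri_natural f x
  lDeltaTheta := Y.lDeltaTheta
  grpLD := Y.grpLD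
  corPiX := Y.corPiX

/-- The `μ_Ẑ`-component of the instance of record IS the genuine cyclotome (definitional).
[claim: Mochizuki2012, status: disputed] (IUTchII §1 Cor 1.11, kurims p.49) -/
theorem ofGaloisCyclotome_muZhat (T : GalTwistInput S) (R : GalRigidityInput A) (Y : GalThetaSyncInput A)
    (G : IsoClass S.Gk) : (ofGaloisCyclotome T R Y).muZhat G = ↥G.galCyclotome :=
  rfl

/-- The transport of the instance of record IS `μ_Ẑ(f)` (definitional).
[claim: Mochizuki2012, status: disputed] (IUTchII §1 Cor 1.11, kurims p.49) -/
theorem ofGaloisCyclotome_mapMu (T : GalTwistInput S) (R : GalRigidityInput A) (Y : GalThetaSyncInput A)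
    {G H : IsoClass S.Gk} (f : G ⟶ H) : (ofGaloisCyclotome T R Y).mapMu f = IsoClass.galCyclotomeMap f :=
  rfl

/-- **B12, the `Π`-transport of record** (sub-DAG row S4 of `plan/L6/SUBDAG-IUTchII-Cor-111.md`, reduced form
`LDTransport` of p414121) for the instance of record: the fields of the Cor. 1.10 (c) input.
[claim: Mochizuki2012, status: disputed] (IUTchII §1 Cor 1.11, kurims p.49) -/
def ofGaloisCyclotomeLD (T : GalTwistInput S) (R : GalRigidityInput A) (Y : GalThetaSyncInput A) :
    (ofGaloisCyclotome T R Y).LDTransport where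
  mapLD h := Y.mapLD h
  mapLD_id P := Y.mapLD_id P
  mapLD_comp f g := Y.mapLD_comp f g
  corPiX_natural h x := Y.corPiX_natural h x

end GaloisPairRigidityData

/-- **IUTchII:Cor1.11 — the functor `ℛ → ℱ` of record over the GENUINE `μ_Ẑ`** (kurims p. 49 ll. 36–44
"determines a functor `ℛ → ℱ` which arises from a functorial algorithm in the triple `(Π, G, α)`"): w5-d089's
`cor111FunctorOfMapLD` at the B12 instance — on objects
`(Π, G) ↦ (μ_Ẑ(G), Λ(O^×(G)), (l·Δ_Θ)(Π), (*bs-Gal_{G,⊳}), (*bs-Gal_{G,Π}))` with `μ_Ẑ(G)` the group-theoretic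
cyclotome, on morphisms `(μ_Ẑ(e), Λ(O^×(e)), (l·Δ_Θ)(h))`. [claim: Mochizuki2012, status: disputed]
(IUTchII §1 Cor 1.11, kurims p.49) -/
abbrev cor111FunctorGalois [CompactSpace S.Gk] {A : AbsTopMonoids S} (T : GalTwistInput S)
    (R : GalRigidityInput A) (Y : GalThetaSyncInput A) (Γ : Subgroup ZHatUnits) (Γ' : Type u) [Group Γ'] :
    IsoClass S.PiX × TwistedIsoClass S.Gk Γ' ⥤ Cor111Tuple.{u} :=
  (GaloisPairRigidityData.ofGaloisCyclotome T R Y).cor111FunctorOfMapLD Γ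
    (GaloisPairRigidityData.ofGaloisCyclotomeLD T R Y) Γ'

/-- **IUTchII:Cor1.11** (kurims p. 49 ll. 44–46) "the resulting natural functor `Ψ_ℛ : ℛ → ℛ†` … is
multiradially defined" — at the functor of record over the genuine `μ_Ẑ` (instance of t1's shape theorem
`cor111_multiradiallyDefined`, the printed proof "follow immediately from the definitions involved").
[claim: Mochizuki2012, status: disputed] (IUTchII §1 Cor 1.11, kurims p.49) -/
theorem cor111FunctorGalois_multiradiallyDefined [CompactSpace S.Gk] {A : AbsTopMonoids S}
    (T : GalTwistInput S) (R : GalRigidityInput A) (Y : GalThetaSyncInput A) (Γ : Subgroup ZHatUnits)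
    (Γ' : Type u) [Group Γ'] :
    ((ex18iii S Γ').toDagger (cor111FunctorGalois T R Y Γ Γ')).IsMultiradiallyDefined :=
  cor111FunctorOfMapLD_multiradiallyDefined _ Γ _ Γ'

/-- The `μ_Ẑ(G)`-entry of the tuple the functor of record assigns to `(Π, G)` is the genuine cyclotome of `G`
(definitional). [claim: Mochizuki2012, status: disputed] (IUTchII §1 Cor 1.11, kurims p.49) -/
theorem cor111FunctorGalois_obj_M [CompactSpace S.Gk] {A : AbsTopMonoids S} (T : GalTwistInput S)
    (R : GalRigidityInput A) (Y : GalThetaSyncInput A) (Γ : Subgroup ZHatUnits) (Γ' : Type u) [Group Γ']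
    (X : IsoClass S.PiX × TwistedIsoClass S.Gk Γ') :
    ((cor111FunctorGalois T R Y Γ Γ').obj X).M = ↥X.2.toIso.galCyclotome :=
  rfl

/-! ## Non-vacuity of the two inputs that do not constrain `A` (DEGENERATE witnesses) -/

/-- Non-vacuity of `GalTwistInput`: the TRIVIAL twist (degenerate witness; the genuine `Ẑ^×`-module structure of
`Λ(−)` is classical and owed as a construction on `EtaleTheta.cyclotome`). [claim: Mochizuki2012, status: disputed]
(IUTchII §1 Cor 1.11, kurims p.49) -/
def GalTwistInput.trivial (S : ThetaSetting.{u}) [CompactSpace S.Gk] : GalTwistInput S where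
  twist _ := 1
  twist_natural f u x := by simp only [MonoidHom.one_apply, MulAut.one_apply]

/-- Non-vacuity of `GalThetaSyncInput`: the TAUTOLOGICAL datum `(l·Δ_Θ)(Π) := μ_Ẑ(Π/Δ)` (genuine cyclotome of
the quotient), `corPiX := id`, transported by `μ_Ẑ(quotMap h)` (laws from `quotMap_id/_comp` and the functor
laws of `μ_Ẑ`). DEGENERATE witness (it forgets `(l·Δ_Θ)`), labelled so; it shows the typed laws are jointly
satisfiable over the genuine `μ_Ẑ`. [claim: Mochizuki2012, status: disputed] (IUTchII §1 Cor 1.11, kurims p.49) -/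
def GalThetaSyncInput.tautological [CompactSpace S.Gk] (A : AbsTopMonoids S) : GalThetaSyncInput A where
  lDeltaTheta P := ↥(A.quotObj P).galCyclotome
  mapLD h := IsoClass.galCyclotomeMap (A.quotMap h)
  mapLD_id P := by
    show IsoClass.galCyclotomeMap (A.quotMap (𝟙 P)) = _
    rw [A.quotMap_id]
    exact IsoClass.galCyclotomeMap_id _
  mapLD_comp f g := by
    show IsoClass.galCyclotomeMap (A.quotMap (f ≫ g)) = _
    rw [A.quotMap_comp]
    exact IsoClass.galCyclotomeMap_comp _ _
  corPiX _ := MulEquiv.refl _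
  corPiX_natural _ _ := rfl

/-- Hence, GIVEN the one genuinely constraining input — the Rmk. 3.2.1 rigidity isomorphism `R` — the Cor. 1.11
functor over the genuine `μ_Ẑ` EXISTS (with the degenerate twist and `Π`-datum): the typed Cor. 1.11 is
inhabited over the group-theoretic cyclotome as soon as (a) is. [claim: Mochizuki2012, status: disputed]
(IUTchII §1 Cor 1.11, kurims p.49) -/
theorem cor111FunctorGalois_multiradiallyDefined_of_rigidity [CompactSpace S.Gk] {A : AbsTopMonoids S}
    (R : GalRigidityInput A) (Γ : Subgroup ZHatUnits) (Γ' : Type u) [Group Γ'] :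
    ((ex18iii S Γ').toDagger
      (cor111FunctorGalois (GalTwistInput.trivial S) R (GalThetaSyncInput.tautological A) Γ Γ')).IsMultiradiallyDefined :=
  cor111FunctorGalois_multiradiallyDefined _ R _ Γ Γ'

/-- The orbit (b) `(*bs-Gal_{G,Π})` of the instance of record is NONEMPTY for every input (it contains
`μ_Ẑ(e) ≫ corPiX` for any `e : G ≅ Π/Δ`, which exists since `IsoClass G_k` is connected).
[claim: Mochizuki2012, status: disputed] (IUTchII §1 Cor 1.11, kurims p.49) -/
theorem ofGaloisCyclotome_orbitB_nonempty [CompactSpace S.Gk] {A : AbsTopMonoids S} (T : GalTwistInput S)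
    (R : GalRigidityInput A) (Y : GalThetaSyncInput A) (P : IsoClass S.PiX) (G : IsoClass S.Gk) :
    ((GaloisPairRigidityData.ofGaloisCyclotome T R Y).orbitB P G).Nonempty := by
  obtain ⟨e⟩ := IsoClass.nonempty_hom G (A.quotObj P)
  exact ⟨_, e, rfl⟩

/-- The orbit (a) `(*bs-Gal_{G,⊳})` of the instance of record is NONEMPTY for every input (it contains the
rigidity isomorphism itself, `1 ∈ Γ`). [claim: Mochizuki2012, status: disputed] (IUTchII §1 Cor 1.11, kurims p.49) -/
theorem ofGaloisCyclotome_orbitA_nonempty [CompactSpace S.Gk] {A : AbsTopMonoids S} (T : GalTwistInput S)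
    (R : GalRigidityInput A) (Y : GalThetaSyncInput A) (Γ : Subgroup ZHatUnits) (G : IsoClass S.Gk) :
    ((GaloisPairRigidityData.ofGaloisCyclotome T R Y).orbitA Γ G).Nonempty := by
  refine ⟨R.bsGalTri G, 1, Γ.one_mem, MulEquiv.ext fun x => ?_⟩
  change R.bsGalTri G x = R.bsGalTri G ((T.twist G 1) x)
  rw [map_one, MulAut.one_apply]

end Literature.IUT.HodgeArakelov

end
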